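import Summits.Schanuel.Schanuel.Theorems.SoloInformedRoyTranslateSharp

/-!
# Roy's criterion: the translates up to the `X₁`-degree decide

The tree's proof of Roy 2001, Proposition 3 (`prop3_core`, `Roy2001_prop3_holds` in
`Literature/NumberTheory/Transcendental/RoyCriterionProp3Proofs.lean`) replaces Roy's two-variable
interpolation (his Theorem 2) by a Taylor expansion along the flow of `D` followed by ONE-variable
Lagrange interpolation of `X ↦ Q(z, e^z X)` at the `deg_{X₁} Q + 1` nodes `β^n`, `β = α e^{-y}`,
`0 ≤ n ≤ deg_{X₁} Q`.  Inspection shows that this argument evaluates hypothesis (b) ONLY at the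
translates `m ≤ deg_{X₁} Q_N ≤ N^{t₁}`; the parameter `s₁` enters solely through `t₁ ≤ s₁`.
This file records the consequence, which sharpens the localisation results of
`SoloInformedRoyTranslateSharp` / `SoloInformedRoyBandCriterion`:

* `not_royConditionB_deg` / `royConditionA_of_royConditionB_deg` (**degree-range criterion**):
  for `α ≠ 0`, `max{1, t₀, 2t₁} < s₀` and `2t₁ < u` (NO `s₁`, NO upper bound on `u`), if for all
  large `N` some `Q_N ≠ 0` with `deg ≤ (N^{t₀}, N^{t₁})`, `H ≤ e^N` has
  `|(D^kQ_N)(my, α^m)| ≤ e^{-N^u}` for `k ≤ N^{s₀}` and `m ≤ N^{t₁}` — i.e. `RoyConditionB` with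
  `t₁` in the translate slot — then `α^d = e^{dy}` for some `d ≥ 1`.
* `roy_thm1_degree_range`: for Roy-admissible parameters, `(b)` with translate exponent `t₁`
  (`< s₁`) is already equivalent to (a) and to (b).
* `roy_content_between_dirichlet_and_degree`: for every `ε > 0`, at the admissible corner
  `t₀ = 1-η, t₁ = ½-η, s₀ = 1+η, s₁ = ½+η, u = 1+2η` (`η = min(ε,¼)/13`): (b) with translate
  exponent
  `t₁` is equivalent to (a) on `ℂ × ℂˣ`, while (b) with translate exponent `t₁ - ε` holds at EVERY
  point of `ℂ²` (`royConditionB_of_lt`).  So the arithmetic content of Roy's criterion sits in the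
  translates `N^{t₁-ε} < m ≤ N^{t₁}`: above the Dirichlet threshold and below the `X₁`-degree; the
  translates `N^{t₁} < m ≤ N^{s₁}` demanded by Theorem 1 are needed only to make (a) ⇒ (b)
  (Proposition 2) and (b) ⇒ (a) meet inside one window.

The proofs of `prop3_core_deg` and `not_royConditionB_deg` are TRANSCRIPTIONS of the tree's
`prop3_core` and `Roy2001_prop3_holds` with the translate range restricted (two lines change); all
lemmas they call (`prop3_taylor`, `prop3_smallness`, `prop3_numeric`, `eventually_prop3_numerics`,
`Roy2001_lemma4`, …) are the tree's.  Credit for the argument is the tree's reproduction of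
Roy 2001;
what is new here is the statement.

References: D. Roy, *An arithmetic criterion for the values of the exponential function*, Acta
Arith. 97 (2001), Thm. 1, Prop. 3, Lemma 4 [Roy2001].
-/

noncomputable section

open MvPolynomial Filter Complex Metric Asymptotics
open Literature.NumberTheory.Transcendental

namespace Summit.Schanuel.Schanuel.Theorems

/-- Transcription of the tree's `prop3_core` with the translate range cut to `m ≤ M^{t₁}` (the
only translates its proof uses are `m ≤ deg_{X₁} Q ≤ M^{t₁}`): for large `M`, if some
`δ ≥ M^{-κ}` separates the powers `β^j` (`1 ≤ j ≤ M^{t₁}`) of `β = α e^{-y}` from `1`, then no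
non-zero `Q` in the box has `|(D^k Q)(m y, α^m)| ≤ e^{-M^u}` for all `k ≤ M^{s₀}`, `m ≤ M^{t₁}`.
Hypotheses: `max{1, t₀, 2t₁} < s₀`, `2t₁ < u` only. [cite: Roy2001, Prop. 3 (proof)] -/
theorem prop3_core_deg {y α : ℂ} (hα : α ≠ 0) {s₀ t₀ t₁ u : ℝ} (hs₀ : 0 < s₀) (ht₁ : 0 < t₁)
    (hu : 0 < u) (h1s₀ : 1 < s₀) (ht₀s₀ : t₀ < s₀) (h2t₁s₀ : 2 * t₁ < s₀) (h2t₁u : 2 * t₁ < u)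
    {κ : ℝ} (hκ : 0 < κ) :
    ∀ᶠ M : ℕ in atTop, ∀ δ : ℝ, 1 ≤ δ * (M : ℝ) ^ κ →
      (∀ j : ℕ, 1 ≤ j → (j : ℝ) ≤ (M : ℝ) ^ t₁ → δ ≤ ‖(α * cexp (-y)) ^ j - 1‖) →
      ∀ Q : MvPolynomial (Fin 2) ℤ, Q ≠ 0 → (Q.degreeOf 0 : ℝ) ≤ (M : ℝ) ^ t₀ →
        (Q.degreeOf 1 : ℝ) ≤ (M : ℝ) ^ t₁ → (mvPolyHeight Q : ℝ) ≤ Real.exp M →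
        ¬ ∀ k m : ℕ, (k : ℝ) ≤ (M : ℝ) ^ s₀ → (m : ℝ) ≤ (M : ℝ) ^ t₁ →
            ‖aeval ![(m : ℂ) * y, α ^ m] (royD^[k] Q)‖ ≤ Real.exp (-(M : ℝ) ^ u) := by
  -- consequences of the parameter inequalities
  have ht₁s₀ : t₁ < s₀ := by linarith
  have ht₁u : t₁ < u := by linarith
  -- the constants attached to `y`, `α`, `β = α e^{-y}`
  have hβ0 : α * cexp (-y) ≠ 0 := mul_ne_zero hα (Complex.exp_ne_zero _)
  have hB1 : 1 ≤ max 1 ‖α * cexp (-y)‖ := le_max_left _ _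
  have hb0 : 0 < min 1 ‖α * cexp (-y)‖ := lt_min one_pos (norm_pos_iff.2 hβ0)
  have hb1 : min 1 ‖α * cexp (-y)‖ ≤ 1 := min_le_left _ _
  have hA1 : 1 ≤ max 1 ‖α‖ := le_max_left _ _
  have hcy0 : 0 ≤ ‖y‖ := norm_nonneg _
  -- numerics
  have H := eventually_prop3_numerics hu hs₀ ht₁.le ht₁u h2t₁u ht₁s₀ h2t₁s₀ ht₀s₀ h1s₀
    (c₁ := 3 + ‖y‖)
    (c₂ := Real.log (max 1 ‖α * cexp (-y)‖) + Real.log (min 1 ‖α * cexp (-y)‖)⁻¹) (c₃ := κ)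
    (c₄ := Real.log (max 1 ‖α * cexp (-y)‖) + Real.log (min 1 ‖α * cexp (-y)‖)⁻¹ +
      Real.log (max 1 ‖α‖) + 2 * ‖y‖)
    (c₅ := 1 + Real.log (3 * (1 + ‖y‖))) hκ.le
  filter_upwards [tendsto_natCast_atTop_atTop.eventually H] with M hM
  obtain ⟨hM1, hX1, hX2⟩ := hM
  intro δ hδ hsep Q hQ hd0 hd1 hH hsmall
  have hM0 : (0 : ℝ) < M := one_pos.trans_le hM1
  have hT₁1 : 1 ≤ (M : ℝ) ^ t₁ := Real.one_le_rpow hM1 ht₁.le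
  have hS₀0 : 0 ≤ (M : ℝ) ^ s₀ := Real.rpow_nonneg hM0.le _
  -- `δ > 0` and `1/δ ≤ M^κ = exp(κ log M)`
  have hMκ : 0 < (M : ℝ) ^ κ := Real.rpow_pos_of_pos hM0 κ
  have hδ0 : 0 < δ := by
    by_contra h
    have : δ * (M : ℝ) ^ κ ≤ 0 := mul_nonpos_of_nonpos_of_nonneg (not_lt.1 h) hMκ.le
    linarith
  have hδinv : δ⁻¹ ≤ Real.exp (κ * Real.log M) := by
    rw [inv_le_iff_one_le_mul₀ hδ0, mul_comm κ, ← Real.rpow_def_of_pos hM0, mul_comm]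
    exact hδ
  -- Step 1
  have hρ : 1 + (Q.degreeOf 1 : ℝ) * ‖y‖ ≤ 1 + (M : ℝ) ^ t₁ * ‖y‖ := by gcongr
  have hstep1 : ∀ n : ℕ, n ≤ Q.degreeOf 1 → ∀ t : ℂ, ‖t‖ ≤ 1 + (M : ℝ) ^ t₁ * ‖y‖ →
      ‖aeval ![(n : ℂ) * y + t, α ^ n * cexp t] Q‖ ≤
        Real.exp (-(M : ℝ) ^ u) * Real.exp (1 + (M : ℝ) ^ t₁ * ‖y‖) +
          2 * (1 / 2) ^ (⌊(M : ℝ) ^ s₀⌋₊ + 1) *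
            ((((Q.degreeOf 0 + 1) * (Q.degreeOf 1 + 1) : ℕ) : ℝ) * mvPolyHeight Q *
              (3 * (1 + (M : ℝ) ^ t₁ * ‖y‖)) ^ Q.degreeOf 0 *
              ((max 1 ‖α‖) ^ Q.degreeOf 1 * Real.exp (2 * (1 + (M : ℝ) ^ t₁ * ‖y‖))) ^
                Q.degreeOf 1) := by
    intro n hn t ht
    refine prop3_taylor Q le_rfl le_rfl hn hρ (Real.exp_pos _).le (le_max_right _ _) hA1
      (fun k hk => hsmall k n ?_ ?_) ht
    · exact (Nat.cast_le.2 (Nat.lt_succ_iff.1 hk)).trans (Nat.floor_le hS₀0)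
    · exact (Nat.cast_le.2 hn).trans hd1
  -- Steps 2–3
  have hsepD : ∀ j : ℕ, 1 ≤ j → j ≤ Q.degreeOf 1 → δ ≤ ‖(α * cexp (-y)) ^ j - 1‖ :=
    fun j hj hjD => hsep j hj ((Nat.cast_le.2 hjD).trans hd1)
  have hA := prop3_smallness hQ le_rfl hρ hδ0 (le_max_right _ _) hB1 le_rfl hb0 hsepD hstep1
  -- Step 4
  have hL : (M : ℝ) ^ s₀ ≤ ((⌊(M : ℝ) ^ s₀⌋₊ + 1 : ℕ) : ℝ) := by
    push_cast; exact (Nat.lt_floor_add_one _).le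
  have hN := prop3_numeric (Real.rpow_nonneg hM0.le t₀) hT₁1 (Real.log_nonneg hM1) hcy0 hκ.le
    hd0 hd1 hL (Real.log_rpow hM0 t₁) (Nat.cast_nonneg _) hH hδ0 hδinv hB1 hb0 hb1 hA1 hX1 hX2
  exact absurd hA (not_le.2 hN)


/-- **Degree-range version of Roy 2001, Proposition 3**: if `α e^{-y}` is not a root of unity,
`max{1, t₀, 2t₁} < s₀` and `2t₁ < u`, then condition (b) WITH TRANSLATE EXPONENT `t₁` fails
(transcription of the tree's `Roy2001_prop3_holds`, both cases `|α e^{-y}| = 1` via Lemma 4 and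
`≠ 1`). [cite: Roy2001, Prop. 3, Lemma 4] -/
theorem not_royConditionB_deg {y α : ℂ} (hα : α ≠ 0) {s₀ t₀ t₁ u : ℝ} (hs₀ : 0 < s₀)
    (ht₁ : 0 < t₁) (hu : 0 < u) (h1s₀ : 1 < s₀) (ht₀s₀ : t₀ < s₀) (h2t₁s₀ : 2 * t₁ < s₀)
    (h2t₁u : 2 * t₁ < u) (hna : ¬ RoyConditionA y α) : ¬ RoyConditionB y α s₀ t₁ t₀ t₁ u := by
  intro hb
  have hβ0 : α * cexp (-y) ≠ 0 := mul_ne_zero hα (Complex.exp_ne_zero _)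
  have hrou : ∀ d : ℕ, 1 ≤ d → (α * cexp (-y)) ^ d ≠ 1 := fun d hd h =>
    hna ((royCondA_iff y α).2 ⟨d, hd, h⟩)
  have hb' : ∀ᶠ M : ℕ in atTop, ∃ Q : MvPolynomial (Fin 2) ℤ, Q ≠ 0 ∧
      (Q.degreeOf 0 : ℝ) ≤ (M : ℝ) ^ t₀ ∧ (Q.degreeOf 1 : ℝ) ≤ (M : ℝ) ^ t₁ ∧
      (mvPolyHeight Q : ℝ) ≤ Real.exp M ∧
      ∀ k m : ℕ, (k : ℝ) ≤ (M : ℝ) ^ s₀ → (m : ℝ) ≤ (M : ℝ) ^ t₁ →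
        ‖aeval ![(m : ℂ) * y, α ^ m] (royD^[k] Q)‖ ≤ Real.exp (-(M : ℝ) ^ u) := hb
  rcases eq_or_ne ‖α * cexp (-y)‖ 1 with hβ1 | hβ1
  · /- Case `|β| = 1`: `β = e^{2πia}` with `a` real irrational; Lemma 4 at a level `N` and
      `M = ⌈N^{1/(t₁+1)}⌉`, so that `M^{t₁} ≪ N ≤ M^{t₁+1}`. -/
    have hκ0 : 0 < t₁ + 1 := by linarith
    have hcore := prop3_core_deg (y := y) hα hs₀ ht₁ hu h1s₀ ht₀s₀ h2t₁s₀ h2t₁u hκ0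
    obtain ⟨M₀, hM₀⟩ := eventually_atTop.1 (hcore.and hb')
    have hairr := forall_ratCast_ne_arg_div hβ1 hrou
    have L4 := Roy2001_lemma4 hairr
    have hN : ∀ᶠ N : ℕ in atTop, (M₀ : ℝ) ≤ (N : ℝ) ^ (1 / (t₁ + 1)) ∧
        (1 + |arg (α * cexp (-y)) / (2 * Real.pi)|) * 2 ^ t₁ * (N : ℝ) ^ (t₁ / (t₁ + 1)) + 1 ≤ N ∧
        (1 : ℝ) ≤ N := by
      have H : ∀ᶠ x : ℝ in atTop, (M₀ : ℝ) ≤ x ^ (1 / (t₁ + 1)) ∧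
          (1 + |arg (α * cexp (-y)) / (2 * Real.pi)|) * 2 ^ t₁ * x ^ (t₁ / (t₁ + 1)) + 1 ≤ x ∧
          1 ≤ x := by
        have hk1 : 0 < 1 / (t₁ + 1) := by positivity
        have hk2 : t₁ / (t₁ + 1) < 1 := by rw [div_lt_one hκ0]; linarith
        filter_upwards [eventually_const_le_mul_rpow (M₀ : ℝ) hk1 one_pos,
          eventually_mul_rpow_le_mul_rpow ((1 + |arg (α * cexp (-y)) / (2 * Real.pi)|) * 2 ^ t₁)
            hk2 (by norm_num : (0 : ℝ) < 1 / 2), eventually_ge_atTop (2 : ℝ)] with x e1 e2 e3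
        refine ⟨by simpa using e1, ?_, by linarith⟩
        rw [Real.rpow_one] at e2; linarith
      exact tendsto_natCast_atTop_atTop.eventually H
    obtain ⟨N, hsepN, hN1, hN2, hN3⟩ := (L4.and_eventually hN).exists
    have hN0 : (0 : ℝ) ≤ (N : ℝ) := Nat.cast_nonneg _
    have hNpos : (0 : ℝ) < N := by linarith
    have hMge : (N : ℝ) ^ (1 / (t₁ + 1)) ≤ (⌈(N : ℝ) ^ (1 / (t₁ + 1))⌉₊ : ℕ) := Nat.le_ceil _
    have hMlt : ((⌈(N : ℝ) ^ (1 / (t₁ + 1))⌉₊ : ℕ) : ℝ) < (N : ℝ) ^ (1 / (t₁ + 1)) + 1 :=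
      Nat.ceil_lt_add_one (Real.rpow_nonneg hN0 _)
    have hM₀M : M₀ ≤ ⌈(N : ℝ) ^ (1 / (t₁ + 1))⌉₊ := by exact_mod_cast hN1.trans hMge
    obtain ⟨hc, Q, hQ, hd0, hd1, hH, hsmall⟩ := hM₀ _ hM₀M
    refine hc (1 / N) ?_ ?_ Q hQ hd0 hd1 hH hsmall
    · have hMκ : (N : ℝ) ≤ ((⌈(N : ℝ) ^ (1 / (t₁ + 1))⌉₊ : ℕ) : ℝ) ^ (t₁ + 1) := by
        calc (N : ℝ) = ((N : ℝ) ^ (1 / (t₁ + 1))) ^ (t₁ + 1) := by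
              rw [← Real.rpow_mul hN0, one_div_mul_cancel hκ0.ne', Real.rpow_one]
          _ ≤ _ := Real.rpow_le_rpow (Real.rpow_nonneg hN0 _) hMge hκ0.le
      rw [one_div, inv_mul_eq_div, le_div_iff₀ hNpos, one_mul]
      exact hMκ
    · intro j hj1 hjT
      set X : ℝ := 2 ^ t₁ * (N : ℝ) ^ (t₁ / (t₁ + 1)) with hX
      have hX0 : 0 ≤ X := by positivity
      have hMt : ((⌈(N : ℝ) ^ (1 / (t₁ + 1))⌉₊ : ℕ) : ℝ) ^ t₁ ≤ X := by
        have h1N : 1 ≤ (N : ℝ) ^ (1 / (t₁ + 1)) := Real.one_le_rpow hN3 (by positivity)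
        calc ((⌈(N : ℝ) ^ (1 / (t₁ + 1))⌉₊ : ℕ) : ℝ) ^ t₁ ≤ ((N : ℝ) ^ (1 / (t₁ + 1)) + 1) ^ t₁ :=
              Real.rpow_le_rpow (Nat.cast_nonneg _) hMlt.le ht₁.le
          _ ≤ (2 * (N : ℝ) ^ (1 / (t₁ + 1))) ^ t₁ :=
              Real.rpow_le_rpow (by positivity) (by linarith) ht₁.le
          _ = X := by
              rw [hX, Real.mul_rpow (by norm_num) (by positivity), ← Real.rpow_mul hN0]
              congr 2; field_simp
      have hj' : (j : ℝ) ≤ X := hjT.trans hMt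
      set A : ℝ := |arg (α * cexp (-y)) / (2 * Real.pi)| with hA
      have hA0 : 0 ≤ A := abs_nonneg _
      have hAX : 0 ≤ A * X := mul_nonneg hA0 hX0
      have e : (1 + A) * X = X + A * X := by ring
      have hjA : (j : ℝ) * A ≤ A * X := by
        rw [mul_comm A X]; exact mul_le_mul_of_nonneg_right hj' hA0
      have hjN : j < N := by
        have : (j : ℝ) < N := by linarith
        exact_mod_cast this
      have hja : j * A + 1 ≤ N := by linarith
      have := two_div_le_norm_pow_sub_one hβ1 hsepN hj1 hjN hja
      calc (1 : ℝ) / N ≤ 2 / N := by gcongr; norm_num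
        _ ≤ _ := this
  · /- Case `|β| ≠ 1`: the powers of `β` stay `≥ | |β| - 1 |` away from `1`. -/
    have hδ0 : 0 < |‖α * cexp (-y)‖ - 1| := abs_pos.2 (sub_ne_zero.2 hβ1)
    have hcore :=
      prop3_core_deg (y := y) hα hs₀ ht₁ hu h1s₀ ht₀s₀ h2t₁s₀ h2t₁u (one_pos : (0 : ℝ) < 1)
    have hδev : ∀ᶠ M : ℕ in atTop, 1 ≤ |‖α * cexp (-y)‖ - 1| * (M : ℝ) ^ (1 : ℝ) :=
      tendsto_natCast_atTop_atTop.eventually (eventually_const_le_mul_rpow 1 one_pos hδ0)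
    obtain ⟨M, hc, ⟨Q, hQ, hd0, hd1, hH, hsmall⟩, hδM⟩ := (hcore.and (hb'.and hδev)).exists
    exact hc _ hδM (fun j hj _ => abs_norm_sub_one_le_norm_pow_sub_one _ hj) Q hQ hd0 hd1 hH hsmall


/-- **Degree-range criterion.** For `α ≠ 0`, `max{1, t₀, 2t₁} < s₀` and `2t₁ < u`: condition (b)
with the translates restricted to `m ≤ N^{t₁}` (the `X₁`-degree range) already forces
`α^d = e^{dy}` for some `d ≥ 1`. No `s₁`, no upper bound on `u`. [cite: Roy2001, Thm. 1, Prop. 3] -/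
theorem royConditionA_of_royConditionB_deg {y α : ℂ} (hα : α ≠ 0) {s₀ t₀ t₁ u : ℝ}
    (hs₀ : 0 < s₀) (ht₁ : 0 < t₁) (hu : 0 < u) (h1s₀ : 1 < s₀) (ht₀s₀ : t₀ < s₀)
    (h2t₁s₀ : 2 * t₁ < s₀) (h2t₁u : 2 * t₁ < u) (hb : RoyConditionB y α s₀ t₁ t₀ t₁ u) :
    RoyConditionA y α := by
  by_contra hna
  exact not_royConditionB_deg hα hs₀ ht₁ hu h1s₀ ht₀s₀ h2t₁s₀ h2t₁u hna hb

/-- **Roy's Theorem 1 with the translate range cut to the `X₁`-degree.** For `α ≠ 0` and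
Roy-admissible `(s₀, s₁, t₀, t₁, u)`: (b) with translate exponent `t₁` ⟺ (a) ⟺ (b) (with `s₁`).
[cite: Roy2001, Thm. 1] -/
theorem roy_thm1_degree_range (y α : ℂ) (hα : α ≠ 0) {s₀ s₁ t₀ t₁ u : ℝ}
    (h : RoyAdmissible s₀ s₁ t₀ t₁ u) :
    (RoyConditionB y α s₀ t₁ t₀ t₁ u ↔ RoyConditionA y α) ∧
      (RoyConditionB y α s₀ s₁ t₀ t₁ u ↔ RoyConditionA y α) := by
  obtain ⟨⟨hs₀, hs₁, ht₀, ht₁, hu⟩, ⟨h1s₀, ht₀s₀, h2t₁s₀, h1s₁, ht₀s₁, h2t₁s₁⟩, ⟨hs₀u, hst, hu2⟩⟩ :=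
    royAdmissible_iff.mp h
  have hBA := (Roy2001_thm1_holds y α hα _ _ _ _ _ h).symm
  refine ⟨⟨fun hb => royConditionA_of_royConditionB_deg hα hs₀ ht₁ hu h1s₀ ht₀s₀ h2t₁s₀
    (by linarith) hb, fun ha => royConditionB_mono y α (by linarith) (hBA.mpr ha)⟩, hBA⟩

/-- **The content of Roy's criterion lies between the Dirichlet threshold and the `X₁`-degree.**
For every `ε > 0`, at the admissible corner `t₀ = 1-η`, `t₁ = ½-η`, `s₀ = 1+η`, `s₁ = ½+η`,
`u = 1+2η` (`η = min(ε,¼)/13`): Theorem 1 holds; (b) with translate exponent `t₁` is already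
equivalent to (a) on `ℂ × ℂˣ`; and (b) with translate exponent `t₁ - ε` holds at EVERY point of
`ℂ²`. [cite: Roy2001, Thm. 1; folklore (Dirichlet)] -/
theorem roy_content_between_dirichlet_and_degree (ε : ℝ) (hε : 0 < ε) :
    ∃ s₀ s₁ t₀ t₁ u : ℝ, RoyAdmissible s₀ s₁ t₀ t₁ u ∧ t₁ < s₁ ∧
      (∀ y α : ℂ, α ≠ 0 → (RoyConditionB y α s₀ s₁ t₀ t₁ u ↔ RoyConditionA y α)) ∧
      (∀ y α : ℂ, α ≠ 0 → (RoyConditionB y α s₀ t₁ t₀ t₁ u ↔ RoyConditionA y α)) ∧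
      ∀ y α : ℂ, RoyConditionB y α s₀ (t₁ - ε) t₀ t₁ u := by
  set ε' : ℝ := min ε (1 / 4) with hε'
  have hε'0 : 0 < ε' := lt_min hε (by norm_num)
  have hε'1 : ε' ≤ 1 / 4 := min_le_right _ _
  have hε'ε : ε' ≤ ε := min_le_left _ _
  set η : ℝ := ε' / 13 with hη
  have hη0 : 0 < η := by rw [hη]; positivity
  have hη13 : 13 * η = ε' := by rw [hη]; ring
  have hadm : RoyAdmissible (1 + η) (1 / 2 + η) (1 - η) (1 / 2 - η) (1 + 2 * η) :=
    royAdmissible_iff.mpr ⟨⟨by linarith, by linarith, by linarith, by linarith, by linarith⟩,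
      ⟨by linarith, by linarith, by linarith, by linarith, by linarith, by linarith⟩,
      ⟨by linarith, by linarith, by linarith⟩⟩
  refine ⟨1 + η, 1 / 2 + η, 1 - η, 1 / 2 - η, 1 + 2 * η, hadm, by linarith, ?_, ?_, ?_⟩
  · intro y α hα
    exact (roy_thm1_degree_range y α hα hadm).2
  · intro y α hα
    exact (roy_thm1_degree_range y α hα hadm).1
  · intro y α
    refine royConditionB_mono y α (show 1 / 2 - η - ε ≤ 1 / 2 - η - ε' by linarith) ?_
    exact royConditionB_of_lt y α (by linarith) (by linarith) (by linarith) (by linarith)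
      (by linarith) (by linarith) (by linarith) (by linarith) (by linarith)

end Summit.Schanuel.Schanuel.Theorems

end
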